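import Literature.NumberTheory.EllipticCurves.BhargavaShankarUnfolding
import Literature.NumberTheory.EllipticCurves.BinaryQuarticIrreducibleInvariance
import HarnessLib

/-!
# Coefficient boxes of the regions `g · B(𝓛)`, the cusp, and the reducible lattice points
# (Bhargava–Shankar §2.2–2.3)

Topic `Literature/NumberTheory/EllipticCurves`; continues `BhargavaShankarUnfolding.lean` (`E(x)`,
`countFn`) and `BhargavaShankarAveragingRegion.lean` (`G₀`, `avgSet`), and uses the box form of
Lemma 2.3 (`BinaryQuarticReducibleCountProofs.ncard_reducible_realBox_le`) and the class invariance
of irreducibility (`BinaryQuarticIrreducibleInvariance.lean`). Everything here is PROVED (no named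
facts).

In Bhargava–Shankar's proof of Theorem 2.1 (`arXiv:1006.1002v2`, §2.3) the number of irreducible
lattice points of `B(n, t, λ, X) = n a(t) k λ G₀ L` is controlled through the shape of its
coefficient box, `a ≪ λ⁴t⁻⁴, b ≪ λ⁴t⁻², c ≪ λ⁴, d ≪ λ⁴t², e ≪ λ⁴t⁴`: in the cusp all lattice
points have `a = 0` and are reducible, and in the main body the reducible ones are few
(Lemma 2.3, and the points with `a = 0`). With the tree's upper-triangular Iwasawa coordinates
`g = ñ(x) a(√y) k(θ)` the roles of `a` and `e` are exchanged (the small coefficient is `e`). We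
prove, for the region `S_g = {coeffs(w ∘ g) : w ∈ B(𝓛)} ⊂ ℝ⁵` (`regionS`):

* `mem_Eset_iff_coeffs_mem`: `g ∈ E(x) ↔ coeffs(x_ℝ) ∈ S_g` (`det g = 1`), and
  `exists_section_of_coeffs_mem`: such `x_ℝ = ℓ ∘ M`, `ℓ ∈ 𝓛`, `det M = 1`;
* `iwasawaGinv_eq_diagTorus_mul` (`ñ(x) a(√y) k(θ) = a(√y) ñ(x/y) k(θ)`), the entry bound `≤ 5`
  for the compact part `ñ(x/y) k(θ) h'⁻¹` (`|x| ≤ ½`, `y ≥ √3/2`, `h' ∈ G₀`), and a uniform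
  constant `C₁` with `|coeffs(f ∘ γ)| ≤ C₁ R` for `|γᵢⱼ| ≤ 5`, `|coeffs f| ≤ R` (compactness);
* **`regionS_coeff_bounds`**: the points of `S_g` satisfy
  `|v_k| ≤ C₁ R y^{2−k}`, `k = 0, …, 4`, when the forms of `𝓛` have coefficients `≤ R`;
* **the cusp** (`e_eq_zero_of_cusp`): if `C₁ R y⁻² < 1` every integral form counted at `g` has
  `e = 0`, hence is not irreducible (`not_isIrreducible_of_e_eq_zero`);
* **the main body** (`C₁ R y⁻² ≥ 1`): the lattice points with `e = 0` are `≤ 256 (C₁R)⁴ y²`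
  (`ncard_e_zero_le`) and the reducible ones with `e ≠ 0` are bounded by Lemma 2.3 in box form
  applied to the reversed forms `f(y, x)` (`ncard_reducible_e_ne_zero_le`), i.e. by
  `K (2B₄B₀)^ε 8(B₄B₃B₂B₁ + B₄B₃B₁B₀ + B₄B₃B₂B₀)` with `B_k = C₁ R y^{2−k}`, which is
  `≪_ε (C₁R)^{4+2ε} (1 + y⁻¹ + y⁻²)`.

## References

* M. Bhargava, A. Shankar, Ann. of Math. (2) 181 (2015) 191–242, §2.2 (Lemma 2.3), §2.3
  (coefficient estimates, cutting off the cusp, displays (14)–(15)); arXiv:1006.1002v2 numbering.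
  [cite: BhargavaShankarAnnals2015, §2.2–2.3 (arXiv:1006.1002v2 numbering)]
-/

noncomputable section

open Real Matrix Set
open scoped MatrixGroups

namespace Literature.NumberTheory.EllipticCurves

namespace BinaryQuartic

open Literature.MeasureTheory.Group

/-! ## Coefficient vectors -/

/-- The form with a given coefficient vector. [folklore] -/
def ofCoeffs {R : Type*} (v : Fin 5 → R) : BinaryQuartic R := ⟨v 0, v 1, v 2, v 3, v 4⟩

/-- `coeffs (ofCoeffs v) = v`. [folklore] -/
@[simp] theorem coeffs_ofCoeffs {R : Type*} (v : Fin 5 → R) : (ofCoeffs v).coeffs = v := by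
  ext i; fin_cases i <;> rfl

/-- `ofCoeffs (coeffs f) = f`. [folklore] -/
@[simp] theorem ofCoeffs_coeffs {R : Type*} (f : BinaryQuartic R) : ofCoeffs f.coeffs = f := by
  ext <;> rfl

/-- Coefficients of the cast form are the casts of the coefficients. [folklore] -/
theorem coeffs_map_intCast (x : BinaryQuartic ℤ) :
    (x.map (Int.castRingHom ℝ)).coeffs = fun k => ((x.coeffs k : ℤ) : ℝ) := by
  ext k; fin_cases k <;> rfl

/-! ## The region `g · B(𝓛)` in coefficient space and the counting function -/

/-- The region `S_g = {coeffs (w ∘ g) : w ∈ B(𝓛)} ⊂ ℝ⁵` of the lattice-point count at `g`: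
`N(g) = #{x ∈ V_ℤ : coeffs x ∈ S_g}`. [cite: BhargavaShankarAnnals2015, §2.3 (the regions B(n,t,λ,X); arXiv:1006.1002v2 numbering)] -/
def regionS (𝓛 : Set (BinaryQuartic ℝ)) (g : Matrix (Fin 2) (Fin 2) ℝ) : Set (Fin 5 → ℝ) :=
  {v | ∃ w ∈ avgSet 𝓛, v = (w.subst g).coeffs}

/-- **`g ∈ E(x) ↔ coeffs(x_ℝ) ∈ S_g`** for `det g = 1`. [folklore] -/
theorem mem_Eset_iff_coeffs_mem {𝓛 : Set (BinaryQuartic ℝ)} {g : Matrix (Fin 2) (Fin 2) ℝ} (hg : g.det = 1)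
    (x : BinaryQuartic ℤ) : g ∈ Eset 𝓛 x ↔ (x.map (Int.castRingHom ℝ)).coeffs ∈ regionS 𝓛 g := by
  have hgu : IsUnit g.det := by rw [hg]; exact isUnit_one
  constructor
  · rintro ⟨-, hmem⟩
    refine ⟨_, hmem, ?_⟩
    rw [← subst_mul, Matrix.mul_nonsing_inv _ hgu, subst_one]
  · rintro ⟨w, hw, hv⟩
    refine ⟨Or.inl hg, ?_⟩
    have : x.map (Int.castRingHom ℝ) = w.subst g := coeffs_injective hv
    rw [this, ← subst_mul, Matrix.nonsing_inv_mul _ hgu, subst_one]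
    exact hw

/-! ## The diagonal part of the Iwasawa decomposition scales the coefficients -/

/-- `coeffs (f ∘ diag(s, s⁻¹)) = (s⁴ a, s² b, c, s⁻² d, s⁻⁴ e)`. [folklore] -/
theorem coeffs_subst_diagTorus (f : BinaryQuartic ℝ) {s : ℝ} (hs : s ≠ 0) :
    (f.subst (diagTorus s)).coeffs = ![s ^ 4 * f.a, s ^ 2 * f.b, f.c, (s⁻¹) ^ 2 * f.d, (s⁻¹) ^ 4 * f.e] := by
  ext k
  fin_cases k <;> simp [coeffs, subst, diagTorus] <;> field_simp

/-- `ñ(u) a(s) = a(s) ñ(u s⁻²)`: moving the shear past the diagonal part rescales it. [folklore] -/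
theorem upperShear_mul_diagTorus (u s : ℝ) (hs : s ≠ 0) :
    upperShear u * diagTorus s = diagTorus s * upperShear (u * (s⁻¹) ^ 2) := by
  rw [upperShear, upperShear, diagTorus]
  ext i j
  fin_cases i <;> fin_cases j <;> simp [Matrix.mul_apply, Fin.sum_univ_two]
  field_simp

/-- Hence `ñ(x) a(√y) k(θ) = a(√y) · (ñ(x/y) k(θ))`. [folklore] -/
theorem iwasawaGinv_eq_diagTorus_mul (x : ℝ) {y : ℝ} (hy : 0 < y) (θ : ℝ) :
    iwasawaGinv x y θ = diagTorus (Real.sqrt y) * (upperShear (x / y) * rotR θ) := by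
  have hs : Real.sqrt y ≠ 0 := (Real.sqrt_pos.2 hy).ne'
  rw [iwasawaGinv, upperShear_mul_diagTorus _ _ hs, Matrix.mul_assoc]
  congr 2
  rw [inv_pow, Real.sq_sqrt hy.le, div_eq_mul_inv]

/-! ## Entry bounds for the compact part -/

/-- Entries of a product of `2 × 2` matrices. [folklore] -/
theorem abs_mul_apply_le {A B : Matrix (Fin 2) (Fin 2) ℝ} {a b : ℝ} (hA : ∀ i j, |A i j| ≤ a)
    (hB : ∀ i j, |B i j| ≤ b) (i j : Fin 2) : |(A * B) i j| ≤ 2 * a * b := by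
  have ha : 0 ≤ a := (abs_nonneg _).trans (hA 0 0)
  rw [Matrix.mul_apply, Fin.sum_univ_two]
  calc |A i 0 * B 0 j + A i 1 * B 1 j| ≤ |A i 0 * B 0 j| + |A i 1 * B 1 j| := abs_add_le _ _
    _ ≤ a * b + a * b := by
        rw [abs_mul, abs_mul]
        exact add_le_add (mul_le_mul (hA _ _) (hB _ _) (abs_nonneg _) ha)
          (mul_le_mul (hA _ _) (hB _ _) (abs_nonneg _) ha)
    _ = 2 * a * b := by ring

/-- Entries of `ñ(u)` for `|u| ≤ 1` are `≤ 1`. [folklore] -/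
theorem abs_upperShear_le {u : ℝ} (hu : |u| ≤ 1) (i j : Fin 2) : |upperShear u i j| ≤ 1 := by
  rw [upperShear]; fin_cases i <;> fin_cases j <;> simp [hu]

/-- Entries of `k(θ)` are `≤ 1`. [folklore] -/
theorem abs_rotR_le (θ : ℝ) (i j : Fin 2) : |rotR θ i j| ≤ 1 := by
  rw [rotR]
  fin_cases i <;> fin_cases j <;> simp [Real.abs_cos_le_one, Real.abs_sin_le_one]

/-- Entries of `h⁻¹` for `h ∈ G₀` are `≤ 5/4`. [folklore] -/
theorem abs_inv_le_of_mem_G0 {h : Matrix (Fin 2) (Fin 2) ℝ} (hh : h ∈ G0) (i j : Fin 2) : |h⁻¹ i j| ≤ 5 / 4 := by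
  obtain ⟨h00, h11, h01, h10⟩ := entries_of_mem_G0 hh
  rw [inv_eq_adjugate_of_mem_G0 hh, Matrix.adjugate_fin_two]
  have e00 := abs_le.1 h00; have e11 := abs_le.1 h11
  fin_cases i <;> fin_cases j <;> simp only [Matrix.of_apply, Matrix.cons_val', Matrix.cons_val_zero,
    Matrix.cons_val_one, Matrix.cons_val_fin_one, Fin.isValue, Fin.zero_eta, Fin.mk_one, abs_neg]
  · rw [abs_le]; constructor <;> linarith
  · exact h01.trans (by norm_num)
  · exact h10.trans (by norm_num)
  · rw [abs_le]; constructor <;> linarith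

/-- **The compact part has entries `≤ 5`**: for `|u| ≤ 1`, any `θ` and `h ∈ G₀`,
`|(ñ(u) k(θ) h⁻¹)_{ij}| ≤ 5`. [folklore] -/
theorem abs_compactPart_le {u : ℝ} (hu : |u| ≤ 1) (θ : ℝ) {h : Matrix (Fin 2) (Fin 2) ℝ} (hh : h ∈ G0)
    (i j : Fin 2) : |(upperShear u * rotR θ * h⁻¹) i j| ≤ 5 := by
  have h1 : ∀ i j, |(upperShear u * rotR θ) i j| ≤ 2 * 1 * 1 :=
    abs_mul_apply_le (abs_upperShear_le hu) (abs_rotR_le θ)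
  have h2 := abs_mul_apply_le h1 (abs_inv_le_of_mem_G0 hh) i j
  linarith

/-! ## A uniform bound for the coefficients of `f ∘ γ` over a compact family -/

/-- The coefficients of `f ∘ γ` depend continuously (polynomially) on `(γ, coeffs f)`. [folklore] -/
theorem continuous_coeffs_subst :
    Continuous fun p : Matrix (Fin 2) (Fin 2) ℝ × (Fin 5 → ℝ) => ((ofCoeffs p.2).subst p.1).coeffs := by
  refine continuous_pi fun k => ?_
  have hc : ∀ i j : Fin 2, Continuous fun p : Matrix (Fin 2) (Fin 2) ℝ × (Fin 5 → ℝ) => p.1 i j :=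
    fun i j => (continuous_apply j).comp ((continuous_apply i).comp continuous_fst)
  have hv : ∀ l : Fin 5, Continuous fun p : Matrix (Fin 2) (Fin 2) ℝ × (Fin 5 → ℝ) => p.2 l :=
    fun l => (continuous_apply l).comp continuous_snd
  have h00 := hc 0 0; have h01 := hc 0 1; have h10 := hc 1 0; have h11 := hc 1 1
  have hv0 := hv 0; have hv1 := hv 1; have hv2 := hv 2; have hv3 := hv 3; have hv4 := hv 4
  fin_cases k <;> simp only [coeffs, subst, ofCoeffs, Matrix.cons_val_zero, Matrix.cons_val_one, Matrix.cons_val,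
    Fin.isValue, Fin.zero_eta, Fin.mk_one, Fin.reduceFinMk] <;> fun_prop

/-- **Uniform coefficient bound**: there is `C₁ > 0` such that `|coeffs(f ∘ γ)_k| ≤ C₁` whenever
`|γᵢⱼ| ≤ 5` and `|coeffs f| ≤ 1` (continuity on a compact set). [folklore] -/
theorem exists_coeffs_subst_bound :
    ∃ C₁ : ℝ, 0 < C₁ ∧ ∀ (γ : Matrix (Fin 2) (Fin 2) ℝ) (f : BinaryQuartic ℝ),
      (∀ i j, |γ i j| ≤ 5) → (∀ l, |f.coeffs l| ≤ 1) → ∀ k, |(f.subst γ).coeffs k| ≤ C₁ := by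
  set K : Set (Matrix (Fin 2) (Fin 2) ℝ × (Fin 5 → ℝ)) :=
    (Set.univ.pi fun _ : Fin 2 => Set.univ.pi fun _ : Fin 2 => Set.Icc (-5 : ℝ) 5) ×ˢ
      (Set.univ.pi fun _ : Fin 5 => Set.Icc (-1 : ℝ) 1) with hK
  have hKc : IsCompact K := by
    refine IsCompact.prod ?_ (isCompact_univ_pi fun _ => isCompact_Icc)
    exact isCompact_univ_pi fun _ => isCompact_univ_pi fun _ => isCompact_Icc
  obtain ⟨C, hC⟩ := hKc.exists_bound_of_continuousOn continuous_coeffs_subst.continuousOn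
  refine ⟨max C 1, by positivity, fun γ f hγ hf k => ?_⟩
  have hmem : (γ, f.coeffs) ∈ K := by
    refine Set.mk_mem_prod ?_ ?_
    · intro i _ j _; exact abs_le.1 (hγ i j)
    · intro l _; exact abs_le.1 (hf l)
  have h := hC _ hmem
  simp only [ofCoeffs_coeffs] at h
  calc |(f.subst γ).coeffs k| = ‖(f.subst γ).coeffs k‖ := (Real.norm_eq_abs _).symm
    _ ≤ ‖(f.subst γ).coeffs‖ := norm_le_pi_norm _ k
    _ ≤ C := h
    _ ≤ max C 1 := le_max_left _ _

/-- A fixed constant `C₁ > 0` as in `exists_coeffs_subst_bound`. [folklore] -/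
def C₁ : ℝ := (exists_coeffs_subst_bound).choose

/-- `C₁ > 0`. [folklore] -/
theorem C₁_pos : 0 < C₁ := (exists_coeffs_subst_bound).choose_spec.1

/-- The defining bound of `C₁`. [folklore] -/
theorem C₁_spec (γ : Matrix (Fin 2) (Fin 2) ℝ) (f : BinaryQuartic ℝ) (hγ : ∀ i j, |γ i j| ≤ 5)
    (hf : ∀ l, |f.coeffs l| ≤ 1) (k : Fin 5) : |(f.subst γ).coeffs k| ≤ C₁ :=
  (exists_coeffs_subst_bound).choose_spec.2 γ f hγ hf k

/-- Scaled version: `|coeffs f| ≤ R ⇒ |coeffs (f ∘ γ)| ≤ C₁ R` for `|γᵢⱼ| ≤ 5`. [folklore] -/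
theorem coeffs_subst_le (γ : Matrix (Fin 2) (Fin 2) ℝ) (f : BinaryQuartic ℝ) (hγ : ∀ i j, |γ i j| ≤ 5)
    {R : ℝ} (hR : 0 ≤ R) (hf : ∀ l, |f.coeffs l| ≤ R) (k : Fin 5) : |(f.subst γ).coeffs k| ≤ C₁ * R := by
  rcases hR.eq_or_lt with hR0 | hRpos
  · -- `R = 0`: `f = 0`
    have hf0 : ∀ l, f.coeffs l = 0 := fun l => abs_nonpos_iff.1 (hR0 ▸ hf l)
    have hfz : f = (0 : ℝ) • f := by
      apply coeffs_injective; ext l; rw [hf0 l, coeffs_smul']; simp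
    rw [hfz, smul_subst, coeffs_smul', Pi.smul_apply, smul_eq_mul, zero_mul, abs_zero, ← hR0, mul_zero]
  · have h1 : ∀ l, |(R⁻¹ • f).coeffs l| ≤ 1 := by
      intro l
      rw [coeffs_smul', Pi.smul_apply, smul_eq_mul, abs_mul, abs_of_pos (inv_pos.2 hRpos)]
      rw [inv_mul_le_iff₀ hRpos, mul_one]; exact hf l
    have h2 := C₁_spec γ (R⁻¹ • f) hγ h1 k
    rw [smul_subst, coeffs_smul', Pi.smul_apply, smul_eq_mul, abs_mul, abs_of_pos (inv_pos.2 hRpos),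
      inv_mul_le_iff₀ hRpos] at h2
    linarith [mul_comm R C₁]

/-! ## Lattice points of `S_g`: the structure of the forms they come from -/

/-- A point of `S_g` is the coefficient vector of `ℓ ∘ M` with `ℓ ∈ 𝓛`, `M = g h'⁻¹`, `h' ∈ G₀`
(`det M = det g`). [folklore] -/
theorem exists_eq_subst_of_mem_regionS {𝓛 : Set (BinaryQuartic ℝ)} {g : Matrix (Fin 2) (Fin 2) ℝ}
    {v : Fin 5 → ℝ} (hv : v ∈ regionS 𝓛 g) :
    ∃ ℓ ∈ 𝓛, ∃ h' ∈ G0, v = (ℓ.subst (g * h'⁻¹)).coeffs := by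
  obtain ⟨w, ⟨h', hh', ℓ, hℓ, rfl⟩, rfl⟩ := hv
  exact ⟨ℓ, hℓ, h', hh', by rw [subst_mul]⟩

/-- **An integral form counted at `g` is `SL₂(ℝ)`-equivalent to a section**: if
`coeffs(x_ℝ) ∈ S_g` (`det g = 1`) then `x_ℝ = ℓ ∘ M` with `ℓ ∈ 𝓛`, `det M = 1`; in particular
`Δ(x) = Δ(ℓ) ≠ 0`, `I(x) = I(ℓ)`, `J(x) = J(ℓ)`. [folklore] -/
theorem exists_section_of_coeffs_mem {𝓛 : Set (BinaryQuartic ℝ)} {g : Matrix (Fin 2) (Fin 2) ℝ} (hg : g.det = 1)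
    {x : BinaryQuartic ℤ} (hx : (x.map (Int.castRingHom ℝ)).coeffs ∈ regionS 𝓛 g) :
    ∃ ℓ ∈ 𝓛, ∃ M : Matrix (Fin 2) (Fin 2) ℝ, M.det = 1 ∧ x.map (Int.castRingHom ℝ) = ℓ.subst M := by
  obtain ⟨ℓ, hℓ, h', hh', hv⟩ := exists_eq_subst_of_mem_regionS hx
  refine ⟨ℓ, hℓ, g * h'⁻¹, ?_, coeffs_injective hv⟩
  rw [Matrix.det_mul, Matrix.det_nonsing_inv, hh'.1, hg]; simp

/-! ## The coefficient box of `S_g` for `g` in the Siegel set -/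

/-- For `g = ñ(x) a(√y) k(θ)` with `|x| ≤ 1/2`, `y ≥ √3/2` (in particular `g` in Gauss's
fundamental domain), the compact part `ñ(x/y) k(θ) h'⁻¹` has entries `≤ 5`. [folklore] -/
theorem abs_compactPart_le' {x y : ℝ} (hx : |x| ≤ 1 / 2) (hy : Real.sqrt 3 / 2 ≤ y) (θ : ℝ)
    {h' : Matrix (Fin 2) (Fin 2) ℝ} (hh' : h' ∈ G0) (i j : Fin 2) :
    |(upperShear (x / y) * rotR θ * h'⁻¹) i j| ≤ 5 := by
  have hy0 : 0 < y := lt_of_lt_of_le (by positivity) hy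
  have h3 : (1 : ℝ) / 2 ≤ Real.sqrt 3 / 2 := by
    have : (1 : ℝ) ≤ Real.sqrt 3 := by
      rw [show (1:ℝ) = Real.sqrt 1 by simp]; exact Real.sqrt_le_sqrt (by norm_num)
    linarith
  have hxy : |x / y| ≤ 1 := by
    rw [abs_div, abs_of_pos hy0, div_le_one hy0]; linarith
  exact abs_compactPart_le hxy θ hh' i j

/-- **The anisotropic coefficient box**: if every `ℓ ∈ 𝓛` has coefficients `≤ R`, then every point
`v` of `S_g`, `g = ñ(x) a(√y) k(θ)` with `|x| ≤ 1/2`, `y ≥ √3/2`, satisfies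
`|v₀| ≤ C₁R y²`, `|v₁| ≤ C₁R y`, `|v₂| ≤ C₁R`, `|v₃| ≤ C₁R y⁻¹`, `|v₄| ≤ C₁R y⁻²`
(Bhargava–Shankar: the coefficients of `B(n,t,λ,X)` are `≪ λ⁴(t⁻⁴, t⁻², 1, t², t⁴)`).
[cite: BhargavaShankarAnnals2015, §2.2–2.3 (coefficient estimates a ≪ t⁻⁴λ⁴, …, e ≪ t⁴λ⁴; arXiv:1006.1002v2 numbering)] -/
theorem regionS_coeff_bounds {𝓛 : Set (BinaryQuartic ℝ)} {R : ℝ} (hR : 0 ≤ R)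
    (hcoef : ∀ ℓ ∈ 𝓛, ∀ l, |ℓ.coeffs l| ≤ R) {x y θ : ℝ} (hx : |x| ≤ 1 / 2) (hy : Real.sqrt 3 / 2 ≤ y)
    {v : Fin 5 → ℝ} (hv : v ∈ regionS 𝓛 (iwasawaGinv x y θ)) :
    |v 0| ≤ C₁ * R * y ^ 2 ∧ |v 1| ≤ C₁ * R * y ∧ |v 2| ≤ C₁ * R ∧ |v 3| ≤ C₁ * R * y⁻¹ ∧
      |v 4| ≤ C₁ * R * (y⁻¹) ^ 2 := by
  have hy0 : 0 < y := lt_of_lt_of_le (by positivity) hy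
  have hs : Real.sqrt y ≠ 0 := (Real.sqrt_pos.2 hy0).ne'
  obtain ⟨ℓ, hℓ, h', hh', rfl⟩ := exists_eq_subst_of_mem_regionS hv
  rw [iwasawaGinv_eq_diagTorus_mul x hy0 θ, Matrix.mul_assoc, subst_mul, coeffs_subst_diagTorus _ hs]
  set γ₀ := upperShear (x / y) * rotR θ * h'⁻¹ with hγ₀
  have hγ : ∀ i j, |γ₀ i j| ≤ 5 := abs_compactPart_le' hx hy θ hh'
  have hb := coeffs_subst_le γ₀ ℓ hγ hR (hcoef ℓ hℓ)
  have e0 : (ℓ.subst (upperShear (x / y) * rotR θ * h'⁻¹)).a = (ℓ.subst γ₀).coeffs 0 := rfl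
  have e1 : (ℓ.subst (upperShear (x / y) * rotR θ * h'⁻¹)).b = (ℓ.subst γ₀).coeffs 1 := rfl
  have e2 : (ℓ.subst (upperShear (x / y) * rotR θ * h'⁻¹)).c = (ℓ.subst γ₀).coeffs 2 := rfl
  have e3 : (ℓ.subst (upperShear (x / y) * rotR θ * h'⁻¹)).d = (ℓ.subst γ₀).coeffs 3 := rfl
  have e4 : (ℓ.subst (upperShear (x / y) * rotR θ * h'⁻¹)).e = (ℓ.subst γ₀).coeffs 4 := rfl
  have hsq2 : Real.sqrt y ^ 2 = y := Real.sq_sqrt hy0.le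
  have hsq4 : Real.sqrt y ^ 4 = y ^ 2 := by rw [show (4:ℕ) = 2 * 2 from rfl, pow_mul, hsq2]
  have hisq2 : (Real.sqrt y)⁻¹ ^ 2 = y⁻¹ := by rw [inv_pow, hsq2]
  have hisq4 : (Real.sqrt y)⁻¹ ^ 4 = (y⁻¹) ^ 2 := by rw [inv_pow, hsq4, inv_pow]
  simp only [Matrix.cons_val_zero, Matrix.cons_val_one, Matrix.cons_val, Fin.isValue]
  rw [e0, e1, e2, e3, e4, abs_mul, abs_mul, abs_mul, abs_mul, hsq4, hsq2, hisq2, hisq4,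
    abs_of_nonneg (by positivity : (0:ℝ) ≤ y ^ 2), abs_of_nonneg hy0.le,
    abs_of_nonneg (by positivity : (0:ℝ) ≤ y⁻¹), abs_of_nonneg (by positivity : (0:ℝ) ≤ (y⁻¹) ^ 2)]
  refine ⟨?_, ?_, hb 2, ?_, ?_⟩
  · calc y ^ 2 * |(ℓ.subst γ₀).coeffs 0| ≤ y ^ 2 * (C₁ * R) := mul_le_mul_of_nonneg_left (hb 0) (by positivity)
      _ = C₁ * R * y ^ 2 := by ring
  · calc y * |(ℓ.subst γ₀).coeffs 1| ≤ y * (C₁ * R) := mul_le_mul_of_nonneg_left (hb 1) hy0.le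
      _ = C₁ * R * y := by ring
  · calc y⁻¹ * |(ℓ.subst γ₀).coeffs 3| ≤ y⁻¹ * (C₁ * R) := mul_le_mul_of_nonneg_left (hb 3) (by positivity)
      _ = C₁ * R * y⁻¹ := by ring
  · calc (y⁻¹) ^ 2 * |(ℓ.subst γ₀).coeffs 4| ≤ (y⁻¹) ^ 2 * (C₁ * R) := mul_le_mul_of_nonneg_left (hb 4) (by positivity)
      _ = C₁ * R * (y⁻¹) ^ 2 := by ring

/-! ## The cusp: small `e`-side forces `e = 0`, hence reducibility -/

/-- A form with `e = 0` is not irreducible (`f(x,1)` is divisible by `x`). [folklore] -/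
theorem not_isIrreducible_of_e_eq_zero {f : BinaryQuartic ℤ} (he : f.e = 0) : ¬ f.IsIrreducible := by
  rintro ⟨ha, hirr⟩
  have hfac : (f.map (Int.castRingHom ℚ)).toPoly =
      Polynomial.X * (Polynomial.C (f.a : ℚ) * Polynomial.X ^ 3 + Polynomial.C (f.b : ℚ) * Polynomial.X ^ 2 +
        Polynomial.C (f.c : ℚ) * Polynomial.X + Polynomial.C (f.d : ℚ)) := by
    simp only [toPoly, map, eq_intCast, he, map_zero, add_zero]
    ring
  rw [hfac] at hirr
  rcases hirr.isUnit_or_isUnit rfl with hu | hu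
  · exact Polynomial.not_isUnit_X hu
  · apply not_isUnit_of_natDegree_pos' _ hu
    have ha' : (f.a : ℚ) ≠ 0 := by exact_mod_cast ha
    have : (Polynomial.C (f.a : ℚ) * Polynomial.X ^ 3 + Polynomial.C (f.b : ℚ) * Polynomial.X ^ 2 +
        Polynomial.C (f.c : ℚ) * Polynomial.X + Polynomial.C (f.d : ℚ)).natDegree = 3 := by
      compute_degree!
    rw [this]; norm_num

/-- **In the cusp the count of irreducible forms vanishes**: if `C₁ R y⁻² < 1` then every integral
form `x` with `coeffs(x_ℝ) ∈ S_g` has `e = 0` and is therefore not irreducible (Bhargava–Shankar: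
"if `a = 0` then `f` is reducible since `y` is a factor"; here with the roles of `a` and `e`
exchanged by the choice of upper-triangular shears). [cite: BhargavaShankarAnnals2015, §2.2 (a = 0 ⇒ reducible) and §2.3 (cutting off the cusp; arXiv:1006.1002v2 numbering)] -/
theorem e_eq_zero_of_cusp {𝓛 : Set (BinaryQuartic ℝ)} {R : ℝ} (hR : 0 ≤ R)
    (hcoef : ∀ ℓ ∈ 𝓛, ∀ l, |ℓ.coeffs l| ≤ R) {x y θ : ℝ} (hx : |x| ≤ 1 / 2) (hy : Real.sqrt 3 / 2 ≤ y)
    (hcusp : C₁ * R * (y⁻¹) ^ 2 < 1) {f : BinaryQuartic ℤ}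
    (hf : (f.map (Int.castRingHom ℝ)).coeffs ∈ regionS 𝓛 (iwasawaGinv x y θ)) : f.e = 0 := by
  obtain ⟨-, -, -, -, h4⟩ := regionS_coeff_bounds hR hcoef hx hy hf
  have h4' : |((f.e : ℤ) : ℝ)| < 1 := lt_of_le_of_lt h4 hcusp
  have : |f.e| < 1 := by exact_mod_cast h4'
  have h2 := abs_lt.1 this
  omega

/-! ## Counting in integer boxes -/

/-- A set mapped injectively into an integer box `∏ᵢ [-Nᵢ, Nᵢ]` is finite with at most
`∏ᵢ (2Nᵢ + 1)` elements. [folklore] -/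
theorem finite_and_ncard_le_of_injOn_pi {α : Type*} {n : ℕ} {T : Set α} (φ : α → (Fin n → ℤ))
    (hinj : Set.InjOn φ T) (N : Fin n → ℕ) (hb : ∀ f ∈ T, ∀ i, |φ f i| ≤ N i) :
    T.Finite ∧ T.ncard ≤ ∏ i, (2 * N i + 1) := by
  classical
  set B : Set (Fin n → ℤ) := ↑(Fintype.piFinset fun i => Finset.Icc (-(N i : ℤ)) (N i)) with hB
  have hBfin : B.Finite := Finset.finite_toSet _
  have hmaps : ∀ f ∈ T, φ f ∈ B := by
    intro f hf
    rw [hB, Fintype.coe_piFinset, Set.mem_univ_pi]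
    intro i
    rw [Finset.coe_Icc, Set.mem_Icc]
    exact abs_le.1 (hb f hf i)
  have hcard : B.ncard = ∏ i, (2 * N i + 1) := by
    rw [hB, Set.ncard_coe_finset, Fintype.card_piFinset]
    refine Finset.prod_congr rfl fun i _ => ?_
    rw [Int.card_Icc]; omega
  refine ⟨Set.Finite.of_finite_image (hBfin.subset ?_) hinj, ?_⟩
  · rintro _ ⟨f, hf, rfl⟩; exact hmaps f hf
  · rw [← hcard]; exact Set.ncard_le_ncard_of_injOn φ hmaps hinj hBfin

/-- Rounding: `|z| ≤ B` for an integer `z` and real `B` gives `|z| ≤ ⌊B⌋₊`. [folklore] -/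
theorem abs_le_floor_of_abs_cast_le {z : ℤ} {B : ℝ} (h : |(z : ℝ)| ≤ B) : |z| ≤ (⌊B⌋₊ : ℕ) := by
  have h1 : ((|z| : ℤ) : ℝ) ≤ B := by push_cast; exact h
  have h2 : (|z|).toNat ≤ ⌊B⌋₊ :=
    Nat.le_floor (by rw [← Int.cast_natCast, Int.toNat_of_nonneg (abs_nonneg z)]; exact h1)
  have := Int.toNat_of_nonneg (abs_nonneg z)
  omega

/-- `2⌊B⌋₊ + 1 ≤ 4B` for `B ≥ 1/2`. [folklore] -/
theorem two_floor_add_one_le {B : ℝ} (hB : 1 / 2 ≤ B) : (2 * (⌊B⌋₊ : ℕ) + 1 : ℝ) ≤ 4 * B := by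
  have := Nat.floor_le (by linarith : (0:ℝ) ≤ B); linarith

/-! ## The two families of reducible lattice points in the main body -/

/-- The side lengths `B_k = C₁ R y^{2−k}` are all `≥ 1/2` once `B₄ ≥ 1` and `y ≥ √3/2`. [folklore] -/
theorem sides_ge_half {R y : ℝ} (hy : Real.sqrt 3 / 2 ≤ y) (hbody : 1 ≤ C₁ * R * (y⁻¹) ^ 2) :
    1 / 2 ≤ C₁ * R * y ^ 2 ∧ 1 / 2 ≤ C₁ * R * y ∧ 1 / 2 ≤ C₁ * R ∧ 1 / 2 ≤ C₁ * R * y⁻¹ := by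
  have h3 : (3 : ℝ) / 4 ≤ y ^ 2 := by
    have hs : Real.sqrt 3 ^ 2 = 3 := Real.sq_sqrt (by norm_num)
    nlinarith [Real.sqrt_nonneg 3]
  have hy0 : 0 < y := lt_of_lt_of_le (by positivity) hy
  have hCR : 0 ≤ C₁ * R := by
    by_contra hneg; push Not at hneg
    have : C₁ * R * (y⁻¹) ^ 2 ≤ 0 := mul_nonpos_of_nonpos_of_nonneg hneg.le (by positivity)
    linarith
  -- `C₁ R ≥ y² ≥ 3/4`
  have hCRy : y ^ 2 ≤ C₁ * R := by
    have e : C₁ * R * (y⁻¹) ^ 2 = C₁ * R / y ^ 2 := by rw [inv_pow]; ring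
    rw [e, le_div_iff₀ (by positivity)] at hbody; linarith
  have hy1 : Real.sqrt 3 / 2 ≤ y := hy
  have hs17 : (17 : ℝ) / 10 ≤ Real.sqrt 3 := by
    rw [show (17:ℝ)/10 = Real.sqrt ((17/10)^2) by rw [Real.sqrt_sq (by norm_num)]]
    exact Real.sqrt_le_sqrt (by norm_num)
  refine ⟨by nlinarith, by nlinarith, by nlinarith, ?_⟩
  rw [show C₁ * R * y⁻¹ = C₁ * R * (y⁻¹) ^ 2 * y by rw [inv_pow]; field_simp]
  nlinarith

/-- **Lattice points with `e = 0`** counted at `g` (all reducible): at most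
`256 (C₁R)⁴ y²`, in the main body `C₁ R y⁻² ≥ 1`. [cite: BhargavaShankarAnnals2015, §2.3 (the points with a = 0 in the main body, display (15); arXiv:1006.1002v2 numbering)] -/
theorem ncard_e_zero_le {𝓛 : Set (BinaryQuartic ℝ)} {R : ℝ} (hR : 0 ≤ R)
    (hcoef : ∀ ℓ ∈ 𝓛, ∀ l, |ℓ.coeffs l| ≤ R) {x y θ : ℝ} (hx : |x| ≤ 1 / 2) (hy : Real.sqrt 3 / 2 ≤ y)
    (hbody : 1 ≤ C₁ * R * (y⁻¹) ^ 2) :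
    ({f : BinaryQuartic ℤ | (f.map (Int.castRingHom ℝ)).coeffs ∈ regionS 𝓛 (iwasawaGinv x y θ) ∧ f.e = 0}).Finite ∧
    (({f : BinaryQuartic ℤ | (f.map (Int.castRingHom ℝ)).coeffs ∈ regionS 𝓛 (iwasawaGinv x y θ) ∧ f.e = 0}).ncard : ℝ) ≤
      256 * (C₁ * R) ^ 4 * y ^ 2 := by
  have hy0 : 0 < y := lt_of_lt_of_le (by positivity) hy
  obtain ⟨s0, s1, s2, s3⟩ := sides_ge_half hy hbody
  set T := {f : BinaryQuartic ℤ | (f.map (Int.castRingHom ℝ)).coeffs ∈ regionS 𝓛 (iwasawaGinv x y θ) ∧ f.e = 0}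
  set N : Fin 4 → ℕ := ![⌊C₁ * R * y ^ 2⌋₊, ⌊C₁ * R * y⌋₊, ⌊C₁ * R⌋₊, ⌊C₁ * R * y⁻¹⌋₊] with hN
  have hinj : Set.InjOn (fun f : BinaryQuartic ℤ => (![f.a, f.b, f.c, f.d] : Fin 4 → ℤ)) T := by
    intro f hf g hg h
    have h0 := congrFun h 0; have h1 := congrFun h 1; have h2 := congrFun h 2; have h3 := congrFun h 3
    simp at h0 h1 h2 h3
    ext
    · exact h0
    · exact h1
    · exact h2
    · exact h3
    · rw [hf.2, hg.2]
  have hb : ∀ f ∈ T, ∀ i, |(![f.a, f.b, f.c, f.d] : Fin 4 → ℤ) i| ≤ N i := by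
    intro f hf i
    obtain ⟨b0, b1, b2, b3, -⟩ := regionS_coeff_bounds hR hcoef hx hy hf.1
    simp only [coeffs_zero, coeffs_one, coeffs_two, coeffs_three] at b0 b1 b2 b3
    fin_cases i
    · exact abs_le_floor_of_abs_cast_le b0
    · exact abs_le_floor_of_abs_cast_le b1
    · exact abs_le_floor_of_abs_cast_le b2
    · exact abs_le_floor_of_abs_cast_le b3
  obtain ⟨hfin, hcard⟩ := finite_and_ncard_le_of_injOn_pi _ hinj N hb
  refine ⟨hfin, ?_⟩
  have hc : (T.ncard : ℝ) ≤ ∏ i : Fin 4, (2 * (N i : ℝ) + 1) := by exact_mod_cast hcard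
  rw [Fin.prod_univ_four] at hc
  simp only [hN, Matrix.cons_val_zero, Matrix.cons_val_one, Matrix.cons_val, Fin.isValue] at hc
  have t0 := two_floor_add_one_le s0
  have t1 := two_floor_add_one_le s1
  have t2 := two_floor_add_one_le s2
  have t3 := two_floor_add_one_le s3
  have p01 : (2 * (⌊C₁ * R * y ^ 2⌋₊ : ℝ) + 1) * (2 * (⌊C₁ * R * y⌋₊ : ℝ) + 1) ≤ 4 * (C₁ * R * y ^ 2) * (4 * (C₁ * R * y)) :=
    mul_le_mul t0 t1 (by positivity) (by linarith)
  have p012 : (2 * (⌊C₁ * R * y ^ 2⌋₊ : ℝ) + 1) * (2 * (⌊C₁ * R * y⌋₊ : ℝ) + 1) * (2 * (⌊C₁ * R⌋₊ : ℝ) + 1) ≤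
      4 * (C₁ * R * y ^ 2) * (4 * (C₁ * R * y)) * (4 * (C₁ * R)) :=
    mul_le_mul p01 t2 (by positivity) (by positivity)
  have p0123 : (2 * (⌊C₁ * R * y ^ 2⌋₊ : ℝ) + 1) * (2 * (⌊C₁ * R * y⌋₊ : ℝ) + 1) * (2 * (⌊C₁ * R⌋₊ : ℝ) + 1) *
      (2 * (⌊C₁ * R * y⁻¹⌋₊ : ℝ) + 1) ≤ 4 * (C₁ * R * y ^ 2) * (4 * (C₁ * R * y)) * (4 * (C₁ * R)) * (4 * (C₁ * R * y⁻¹)) :=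
    mul_le_mul p012 t3 (by positivity) (by positivity)
  have e : 4 * (C₁ * R * y ^ 2) * (4 * (C₁ * R * y)) * (4 * (C₁ * R)) * (4 * (C₁ * R * y⁻¹)) = 256 * (C₁ * R) ^ 4 * y ^ 2 := by
    field_simp; ring
  linarith

/-- The reversal `f(x,y) ↦ f(y,x)`: `f ∘ (0 1; 1 0) = (e, d, c, b, a)`. [folklore] -/
theorem subst_flip (f : BinaryQuartic ℤ) : f.subst !![0, 1; 1, 0] = ⟨f.e, f.d, f.c, f.b, f.a⟩ := by
  ext <;> simp [subst]

/-- **Reducible lattice points with `e ≠ 0`** counted at `g`: at most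
`K (4B₄B₀)^ε · 16 (B₄B₃B₂B₁ + B₄B₃B₁B₀ + B₄B₃B₂B₀)` by Lemma 2.3 in box form
(`ncard_reducible_realBox_le`, applied to the reversed forms `f(y,x)`), where
`B_k = C₁ R y^{2−k}`. [cite: BhargavaShankarAnnals2015, Lemma 2.3 (arXiv:1006.1002v2 numbering)] -/
theorem ncard_reducible_e_ne_zero_le {ε K : ℝ}
    (hK : ∀ A B C D E : ℝ, 1 ≤ A → 1 ≤ B → 1 ≤ C → 1 ≤ D → 1 ≤ E →
      ({f : BinaryQuartic ℤ | f.a ≠ 0 ∧ ¬ f.IsIrreducible ∧ |(f.a : ℝ)| ≤ A ∧ |(f.b : ℝ)| ≤ B ∧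
            |(f.c : ℝ)| ≤ C ∧ |(f.d : ℝ)| ≤ D ∧ |(f.e : ℝ)| ≤ E}.ncard : ℝ) ≤
        K * (A * E) ^ ε * (A * B * C * D + A * B * D * E + A * B * C * E))
    {𝓛 : Set (BinaryQuartic ℝ)} {R : ℝ} (hR : 0 ≤ R)
    (hcoef : ∀ ℓ ∈ 𝓛, ∀ l, |ℓ.coeffs l| ≤ R) {x y θ : ℝ} (hx : |x| ≤ 1 / 2) (hy : Real.sqrt 3 / 2 ≤ y)
    (hbody : 1 ≤ C₁ * R * (y⁻¹) ^ 2) :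
    ({f : BinaryQuartic ℤ | (f.map (Int.castRingHom ℝ)).coeffs ∈ regionS 𝓛 (iwasawaGinv x y θ) ∧ f.e ≠ 0 ∧
        ¬ f.IsIrreducible}).Finite ∧
    (({f : BinaryQuartic ℤ | (f.map (Int.castRingHom ℝ)).coeffs ∈ regionS 𝓛 (iwasawaGinv x y θ) ∧ f.e ≠ 0 ∧
        ¬ f.IsIrreducible}).ncard : ℝ) ≤
      K * ((C₁ * R * (y⁻¹) ^ 2) * (2 * (C₁ * R * y ^ 2))) ^ ε *
        ((C₁ * R * (y⁻¹) ^ 2) * (2 * (C₁ * R * y⁻¹)) * (2 * (C₁ * R)) * (2 * (C₁ * R * y)) +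
         (C₁ * R * (y⁻¹) ^ 2) * (2 * (C₁ * R * y⁻¹)) * (2 * (C₁ * R * y)) * (2 * (C₁ * R * y ^ 2)) +
         (C₁ * R * (y⁻¹) ^ 2) * (2 * (C₁ * R * y⁻¹)) * (2 * (C₁ * R)) * (2 * (C₁ * R * y ^ 2))) := by
  have hy0 : 0 < y := lt_of_lt_of_le (by positivity) hy
  obtain ⟨s0, s1, s2, s3⟩ := sides_ge_half hy hbody
  set T := {f : BinaryQuartic ℤ | (f.map (Int.castRingHom ℝ)).coeffs ∈ regionS 𝓛 (iwasawaGinv x y θ) ∧ f.e ≠ 0 ∧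
        ¬ f.IsIrreducible}
  -- the target box of reversed forms
  set A : ℝ := C₁ * R * (y⁻¹) ^ 2
  set B : ℝ := 2 * (C₁ * R * y⁻¹)
  set C : ℝ := 2 * (C₁ * R)
  set D : ℝ := 2 * (C₁ * R * y)
  set E : ℝ := 2 * (C₁ * R * y ^ 2)
  set T' := {f : BinaryQuartic ℤ | f.a ≠ 0 ∧ ¬ f.IsIrreducible ∧ |(f.a : ℝ)| ≤ A ∧ |(f.b : ℝ)| ≤ B ∧
            |(f.c : ℝ)| ≤ C ∧ |(f.d : ℝ)| ≤ D ∧ |(f.e : ℝ)| ≤ E}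
  have hflipunit : IsUnit (!![0, 1; 1, 0] : Matrix (Fin 2) (Fin 2) ℤ).det := by
    rw [Matrix.det_fin_two_of]; norm_num
  have hmaps : ∀ f ∈ T, f.subst !![0, 1; 1, 0] ∈ T' := by
    rintro f ⟨hf, he, hirr⟩
    obtain ⟨b0, b1, b2, b3, b4⟩ := regionS_coeff_bounds hR hcoef hx hy hf
    simp only [coeffs_zero, coeffs_one, coeffs_two, coeffs_three, coeffs_four] at b0 b1 b2 b3 b4
    rw [subst_flip]
    refine ⟨he, ?_, b4, b3.trans (by linarith), b2.trans (by linarith), b1.trans (by linarith), b0.trans (by linarith)⟩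
    rw [← subst_flip, isIrreducible_subst_iff hflipunit]; exact hirr
  have hFF : (!![0, 1; 1, 0] : Matrix (Fin 2) (Fin 2) ℤ) * !![0, 1; 1, 0] = 1 := by
    ext i j; fin_cases i <;> fin_cases j <;> simp [Matrix.mul_apply, Fin.sum_univ_two]
  have hinj : Set.InjOn (fun f : BinaryQuartic ℤ => f.subst !![0, 1; 1, 0]) T := by
    intro f _ g _ h
    have h' : f.subst !![0, 1; 1, 0] = g.subst !![0, 1; 1, 0] := h
    calc f = (f.subst !![0, 1; 1, 0]).subst !![0, 1; 1, 0] := by rw [← subst_mul, hFF, subst_one]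
      _ = (g.subst !![0, 1; 1, 0]).subst !![0, 1; 1, 0] := by rw [h']
      _ = g := by rw [← subst_mul, hFF, subst_one]
  -- `T'` is finite (it lies in an integer box)
  have hT'fin : T'.Finite := by
    refine (finite_and_ncard_le_of_injOn_pi (fun f : BinaryQuartic ℤ => f.coeffs) (coeffs_injective.injOn)
      ![⌊A⌋₊, ⌊B⌋₊, ⌊C⌋₊, ⌊D⌋₊, ⌊E⌋₊] ?_).1
    rintro f ⟨-, -, ha, hb, hc, hd, he⟩ i
    fin_cases i
    · exact abs_le_floor_of_abs_cast_le ha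
    · exact abs_le_floor_of_abs_cast_le hb
    · exact abs_le_floor_of_abs_cast_le hc
    · exact abs_le_floor_of_abs_cast_le hd
    · exact abs_le_floor_of_abs_cast_le he
  have hle := Set.ncard_le_ncard_of_injOn _ hmaps hinj hT'fin
  refine ⟨Set.Finite.of_finite_image (hT'fin.subset ?_) hinj, ?_⟩
  · rintro _ ⟨f, hf, rfl⟩; exact hmaps f hf
  · calc (T.ncard : ℝ) ≤ T'.ncard := by exact_mod_cast hle
      _ ≤ _ := hK A B C D E hbody (by linarith) (by linarith) (by linarith) (by linarith)

end BinaryQuartic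

end Literature.NumberTheory.EllipticCurves

end
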